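import Summits.Parity.GeneralizedHardyLittlewood.Theorems.LeeYangFibresCellsToRelativeDimOneCounts
import HarnessLib

/-!
# Asymptotic tools for `PrimeCellsRelative ⟹ Hardy–Littlewood` certificates (crux stmt-Parity-14112)

Route-file-free lemmas shared by the hardness certificates of the crux `PrimeCellsRelative` (route
`LeeYangFibres`, Parity / GeneralizedHardyLittlewood, line `Sketch`) that derive Hardy–Littlewood
ASYMPTOTICS (prime `k`-tuples, parity.S01; binary Goldbach, parity.S35) from the counting cell
asymptotic of the crux:

* `rpow_inv_le_sqrt` — `N^{1/u} ≤ √N` (`u ≥ 2`);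
* `roughDensity_window` — two-sided prime number theorem window for the rough prime density
  `A₁(N) log N / N ∈ [1 - η, 1 + η]` (decidability instance as an implicit argument, so that it
  unifies with the finset printed in the route file);
* `errCount_mul_log_pow_le` — the cell/prime-point discrepancy `k (2 x^{1/u} + 1)` is
  `o(x / log^k x)` once `log^{k+1} x ≤ c √x`;
* `hl_arith` — the real arithmetic assembling `|P - 𝔖 x/log^k x| ≤ δ 𝔖 x/log^k x` from the crux's
  relative + absolute bound, the count sandwich, the archimedean and PNT windows.

References: B. Green, T. Tao, Ann. of Math. 171 (2010), Conj. 1.4 (sketch proof) [GreenTao2010];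
H. L. Montgomery, R. C. Vaughan, *Multiplicative Number Theory I*, §8.1 [MontgomeryVaughan2007].
-/

noncomputable section

namespace Summit.Parity.GeneralizedHardyLittlewood.Cruxes.PrimeCellsRelative.Sketch

open scoped BigOperators Topology Classical
open Filter Finset Literature.NumberTheory.Sieve
open Summit.Parity.GeneralizedHardyLittlewood.Theorems.LeeYangFibresCells

/-! ### Elementary inputs -/

/-- `N^{1/u} ≤ √N` for `N ≥ 1`, `u ≥ 2`. [folklore] -/
theorem rpow_inv_le_sqrt {N : ℝ} {u : ℕ} (hN : 1 ≤ N) (hu : 2 ≤ u) :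
    N ^ ((1 : ℝ) / u) ≤ Real.sqrt N := by
  rw [Real.sqrt_eq_rpow]
  refine Real.rpow_le_rpow_of_exponent_le hN ?_
  have : (2 : ℝ) ≤ u := by exact_mod_cast hu
  rw [one_div_le (by positivity) (by norm_num), one_div_one_div]
  exact this

/-- **Two-sided prime number theorem window for the rough prime density**: inside the window
(`eventually_primeCounting_window` at precision `η`), for `u ≥ 2`,
`1 - η ≤ (A₁(N)/N) log N ≤ 1 + η` with `A₁(N) = #{m ≤ N : P⁻(m) > N^{1/u}, Ω(m) = 1}`. The
decidability instance is an implicit ARGUMENT (unified from the route file's finset).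
[cite: MontgomeryVaughan2007, §8.1 eq. (8.1)] -/
theorem roughDensity_window {N u : ℕ} {η : ℝ}
    {hdec : DecidablePred fun m : ℕ => (N : ℝ) ^ ((1 : ℝ) / u) < (Nat.minFac m : ℝ) ∧
      ArithmeticFunction.cardFactors m = 1}
    (hwin : ∀ A : ℝ, (Nat.primeCounting N : ℝ) - Real.sqrt N ≤ A → A ≤ Nat.primeCounting N →
      (1 - η) * N ≤ A * Real.log N ∧ A * Real.log N ≤ (1 + η) * N)
    (hN : 1 ≤ N) (hu : 2 ≤ u) :
    1 - η ≤ (#((Icc 1 N).filter fun m => (N : ℝ) ^ ((1 : ℝ) / u) < (Nat.minFac m : ℝ) ∧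
        ArithmeticFunction.cardFactors m = 1) : ℝ) / N * Real.log N ∧
      (#((Icc 1 N).filter fun m => (N : ℝ) ^ ((1 : ℝ) / u) < (Nat.minFac m : ℝ) ∧
        ArithmeticFunction.cardFactors m = 1) : ℝ) / N * Real.log N ≤ 1 + η := by
  have hZ0 : 0 ≤ (N : ℝ) ^ ((1 : ℝ) / u) := Real.rpow_nonneg (Nat.cast_nonneg N) _
  have hN1' : (1 : ℝ) ≤ N := by exact_mod_cast hN
  have hN0 : (0 : ℝ) < N := by linarith
  have hZle := rpow_inv_le_sqrt hN1' hu
  have hlo := primeCounting_le_card_roughPrimes_add N hZ0 (hdec := hdec)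
  have hhi := card_roughPrimes_le_primeCounting N ((N : ℝ) ^ ((1 : ℝ) / u)) (hdec := hdec)
  obtain ⟨h1, h2⟩ := hwin _ (by linarith) hhi
  rw [div_mul_eq_mul_div, le_div_iff₀ hN0, div_le_iff₀ hN0]
  exact ⟨by linarith, by linarith⟩

/-- **The error count is negligible**: for `x ≥ 1`, `u ≥ 2`, `log x ≥ 1` and
`log^{k+1} x ≤ c √x` one has `k (2 x^{1/u} + 1) log^k x ≤ 3 k c x`. [folklore] -/
theorem errCount_mul_log_pow_le {k u : ℕ} {x c : ℝ} (hx : 1 ≤ x) (hu : 2 ≤ u)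
    (hlog1 : 1 ≤ Real.log x) (hgrow : Real.log x ^ (k + 1) ≤ c * Real.sqrt x) :
    (k : ℝ) * (2 * x ^ ((1 : ℝ) / u) + 1) * Real.log x ^ k ≤ 3 * k * c * x := by
  have hs1 : 1 ≤ Real.sqrt x := by rw [Real.one_le_sqrt]; exact hx
  have hZ := rpow_inv_le_sqrt hx hu
  have hZ3 : 2 * x ^ ((1 : ℝ) / u) + 1 ≤ 3 * Real.sqrt x := by linarith
  have hL0 : 0 ≤ Real.log x ^ k := pow_nonneg (by linarith) k
  have hLk : Real.log x ^ k ≤ Real.log x ^ (k + 1) := by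
    rw [pow_succ]; exact le_mul_of_one_le_right hL0 hlog1
  have hk0 : (0 : ℝ) ≤ k := Nat.cast_nonneg k
  have hss : Real.sqrt x * Real.sqrt x = x := Real.mul_self_sqrt (by linarith)
  calc (k : ℝ) * (2 * x ^ ((1 : ℝ) / u) + 1) * Real.log x ^ k
      ≤ k * (3 * Real.sqrt x) * (c * Real.sqrt x) := by
        refine mul_le_mul (mul_le_mul_of_nonneg_left hZ3 hk0) (hLk.trans hgrow) hL0 ?_
        positivity
    _ = 3 * k * c * (Real.sqrt x * Real.sqrt x) := by ring
    _ = 3 * k * c * x := by rw [hss]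

/-- **Real arithmetic of the Hardy–Littlewood asymptotic.** From the crux's asymptotic
`|C - β s r^k| ≤ ε (β s r^k + x/log^k x)` for the cell count `C`, the sandwich `C ≤ P ≤ C + E`
for the tuple count `P`, the error bound `E log^k x ≤ (δ/8) s x`, the archimedean window
`(1 - δ/8) x ≤ β ≤ x`, the prime number theorem window `1 - δ/8 ≤ (r log x)^k ≤ 1 + δ/8` and
`ε (2 s + 1) ≤ (δ/8) s`: `|P - s x/log^k x| ≤ δ s x/log^k x`. [folklore] -/
theorem hl_arith (k : ℕ) {C P β s r x ε δ E : ℝ}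
    (hb : |C - β * s * r ^ k| ≤ ε * (β * s * r ^ k + x / Real.log x ^ k))
    (hP1 : C ≤ P) (hP2 : P ≤ C + E)
    (hx : 0 < x) (hlog : 0 < Real.log x) (hs : 0 < s) (hδ : 0 < δ) (hδ1 : δ ≤ 1) (hε0 : 0 ≤ ε)
    (hε : ε * (2 * s + 1) ≤ δ / 8 * s)
    (hE : E * Real.log x ^ k ≤ δ / 8 * (s * x))
    (hβ1 : (1 - δ / 8) * x ≤ β) (hβ2 : β ≤ x)
    (hρ1 : 1 - δ / 8 ≤ (r * Real.log x) ^ k) (hρ2 : (r * Real.log x) ^ k ≤ 1 + δ / 8) :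
    |P - s * x / Real.log x ^ k| ≤ δ * |s * x / Real.log x ^ k| := by
  set L := Real.log x ^ k with hL
  have hL0 : 0 < L := pow_pos hlog k
  set g := s * x / L with hg
  have hg0 : 0 < g := div_pos (mul_pos hs hx) hL0
  have hgL : g * L = s * x := div_mul_cancel₀ _ hL0.ne'
  have hxL : x / L = g / s := by rw [hg]; field_simp
  set M := β * s * r ^ k with hM
  set ρk := (r * Real.log x) ^ k with hρk
  have hML : M * L = β * s * ρk := by rw [hM, hρk, hL, mul_pow]; ring
  have hβ0 : 0 ≤ β := le_trans (mul_nonneg (by linarith) hx.le) hβ1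
  -- the main term against the target, multiplied through by `L`
  have h1 : (1 - δ / 8) * ((1 - δ / 8) * (s * x)) ≤ M * L := by
    rw [hML]
    have h' : (1 - δ / 8) * x * s ≤ β * s := mul_le_mul_of_nonneg_right hβ1 hs.le
    calc (1 - δ / 8) * ((1 - δ / 8) * (s * x)) = ((1 - δ / 8) * x * s) * (1 - δ / 8) := by ring
      _ ≤ (β * s) * ρk := mul_le_mul h' hρ1 (by linarith) (mul_nonneg hβ0 hs.le)
      _ = β * s * ρk := by ring
  have h2 : M * L ≤ (1 + δ / 8) * (s * x) := by
    rw [hML]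
    calc β * s * ρk ≤ (x * s) * (1 + δ / 8) :=
          mul_le_mul (mul_le_mul_of_nonneg_right hβ2 hs.le) hρ2 (le_trans (by linarith) hρ1)
            (mul_nonneg hx.le hs.le)
      _ = (1 + δ / 8) * (s * x) := by ring
  have hsx : 0 ≤ s * x := mul_nonneg hs.le hx.le
  have hM1 : (1 - δ / 4) * g ≤ M := by
    refine le_of_mul_le_mul_right ?_ hL0
    have h3 : (1 - δ / 4) * (s * x) ≤ (1 - δ / 8) * ((1 - δ / 8) * (s * x)) := by nlinarith
    calc (1 - δ / 4) * g * L = (1 - δ / 4) * (s * x) := by rw [mul_assoc, hgL]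
      _ ≤ M * L := h3.trans h1
  have hM2 : M ≤ (1 + δ / 8) * g := by
    refine le_of_mul_le_mul_right ?_ hL0
    calc M * L ≤ (1 + δ / 8) * (s * x) := h2
      _ = (1 + δ / 8) * g * L := by rw [mul_assoc, hgL]
  have hM0 : 0 ≤ M := le_trans (mul_nonneg (by linarith) hg0.le) hM1
  -- the three error terms, each `≤ (δ/8) g` (the main-term one `≤ (δ/4) g`)
  have hEg : E ≤ δ / 8 * g := by
    refine le_of_mul_le_mul_right ?_ hL0
    calc E * L ≤ δ / 8 * (s * x) := hE
      _ = δ / 8 * g * L := by rw [mul_assoc, hgL]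
  have hεg : ε * (M + x / L) ≤ δ / 8 * g := by
    rw [hxL]
    have hεM : ε * M ≤ ε * ((1 + δ / 8) * g) := mul_le_mul_of_nonneg_left hM2 hε0
    have hεg0 : 0 ≤ ε * g := mul_nonneg hε0 hg0.le
    have e1 : ε * (M + g / s) = ε * M + ε * g / s := by ring
    have e2 : ε * M + ε * g / s ≤ 2 * (ε * g) + ε * g / s := by nlinarith
    have e3 : 2 * (ε * g) + ε * g / s = ε * (2 * s + 1) * g / s := by field_simp
    have e4 : ε * (2 * s + 1) * g / s ≤ δ / 8 * g := by
      rw [div_le_iff₀ hs]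
      have := mul_le_mul_of_nonneg_right hε hg0.le
      nlinarith
    linarith
  obtain ⟨hlo, hhi⟩ := abs_le.mp hb
  have habs : |s * x / L| = g := abs_of_pos hg0
  rw [habs, abs_le]
  constructor
  · nlinarith
  · nlinarith

end Summit.Parity.GeneralizedHardyLittlewood.Cruxes.PrimeCellsRelative.Sketch

end
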